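import Mathlib
import HarnessLib
import Summits.HubbardSuperconductivity.HubbardSuperconductivity.Theorems.KLProgrammeKLRegimeEngineTwoLegStepV17F2ZeroCloserSpLeg

/-!
# Stub (M) `stub_twoLeg_scale0` of `KLRegimeEngineV17F2` (stmt-HubbardSuperconductivity-20437) with the package `(G, Q)`, the thresholds AND the
# reading-jet tables `(cJ, cJ′)` as binders — the v2-ready (M) closer («CE-GENERIC» (R47q), «JET-TABLE-GENERIC» (R47r); cell gate-hubbard-kl, seat p1b g9)

The registered (M) (skeleton v1 f8654925219fd273) is closed at the literal package `klEngGeo7 / klEngQ7 P R / klEngU₀9 / klC4aJetC` by `stub_twoLeg_scale0`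
(…ZeroStubM, p547354).  Skeleton v2 (≤ 09-01) re-keys the package (tokens #13 `klEngQ7 ↦ klEngQ8|Q9`, #14 `klEngU₀9 ↦ klEngU₀10`, #15 `klEngGeo7 ↦ klEngGeo8`,
#16 `klEngL₃ ↦ klEngL₄`, #9′ `klC4aJetC ↦ klC4aJetC2`); this file makes the v2 (M) re-closer ONE `exact` line by taking everything the (M) chain reads as
binders/rows: `hGS : cJ ≤ G.S`, `hQS : cJ′ ≤ Q.S′`, `hQCL : 0 ≤ Q.CL`, **`hQCL4 : 4 ≤ Q.CL β 0`** (the quarter budget dominates `1/L₁`), **`hQM0 : klEngM₃ β U ≤ Q.M0 β`**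
(the Matsubara threshold of the two-volume clause), the doors `c₃ ≤ klEngC₃3 P R`, `U₀c ≤ klEngU₀9 P R c` (both v2 thresholds sit below these).

* `twoLeg_scale0_hcut_GQ` — the cutoff nested leg at scale `0` for any such `Q` (k3c4-p2's `twoLeg_scale0_hcutF_of_small`, `U ≤ klEngU₀4`);
* `twoLeg_scale0_hsp_GQ` — the spatial nested leg at scale `0` for any such `Q` (p1b's `abs_klLocalPart_flowFrame_zero_spLeg_le_inv`, `U ≤ klEngU₀9`);
* **`stub_twoLeg_scale0_GQJ`** — (M)'s conclusion `TwoLegStepV17F2 L M G P Q R β U μ 0` from (M)'s binders at `(G, Q, cJ, cJ′, c₃, U₀c)` (p1b g8's generic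
  `twoLegStepV17F2_zero_of_readJetBound_bareSlopes` + `bareFrame_numerals_of_le_klEngU₀9` + the two legs);
* `stub_twoLeg_scale0_GQJ_klEng7` — sanity instance: the registered v1 package recovers `stub_twoLeg_scale0`'s statement (rows `klC4aJetC_le_klEngGeo7_S`,
  `klC4aJetC'_le_klEngQ7_S'`, `klEngQ7_CL/M0` rfl, `four_le_klEngQ6_CL_zero`).

Proofs only; no definitions; nothing asserts superconductivity.  References: BGM 2006 §2–§3 [cite: BenfattoGiulianiMastropietro2006].
-/

noncomputable section

namespace Summit.HubbardSuperconductivity.HubbardSuperconductivity.Theorems.EngineV8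

set_option linter.dupNamespace false -- summit = problem name (single-conjunct summit), D-0017

open Real Finset Literature.MathematicalPhysics.QuantumLattice Literature.Probability.LatticeModels
open Literature.MathematicalPhysics.QuantumLattice.FermiRG Literature.MathematicalPhysics.QuantumLattice.BandSectorCounting
open Summit.HubbardSuperconductivity.HubbardSuperconductivity.Theorems.KLProgrammeLegKernels
open Summit.HubbardSuperconductivity.HubbardSuperconductivity.Theorems.DispersionFlow
open Summit.HubbardSuperconductivity.HubbardSuperconductivity.Theorems.PerturbedFermiCurve
open Summit.HubbardSuperconductivity.HubbardSuperconductivity.Theorems.KLRegimeSplit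
open Summit.HubbardSuperconductivity.HubbardSuperconductivity.Theorems.TwoVolumeDefect

/-! ## §1 The two nested legs at scale `0` for a generic package `Q` -/

/-- `U ≤ klEngU₀4 P R c ⟹ U ≤ 2^-128/klEngRsq R⁴` (the smallness read by k3c4-p2's cutoff leg). -/
theorem le_inv_two_pow_rsq_of_le_klEngU₀4 (P : SplitConsts) {R : RenConsts} {c U : ℝ} (hU₀ : U ≤ klEngU₀4 P R c) :
    U ≤ 1 / ((2 : ℝ) ^ 128 * klEngRsq R ^ 4) := by
  refine hU₀.trans ?_
  rw [klEngU₀4]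
  have hRpos : 0 < klEngRsq R := lt_of_lt_of_le one_pos (one_le_klEngRsq R)
  refine one_div_le_one_div_of_le (by positivity) ?_
  have hP : (1 : ℝ) ≤ klEngPsq P ^ 4 := one_le_pow₀ (one_le_klEngPsq P)
  have hc2 : (1 : ℝ) ≤ c ^ 2 + 1 := by nlinarith [sq_nonneg c]
  calc (2 : ℝ) ^ 128 * klEngRsq R ^ 4 = (2 : ℝ) ^ 128 * 1 * klEngRsq R ^ 4 * 1 := by ring
    _ ≤ (2 : ℝ) ^ 128 * klEngPsq P ^ 4 * klEngRsq R ^ 4 * (c ^ 2 + 1) := by gcongr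

/-- **The CUTOFF nested leg of (E3f-F)₀ for a generic package `Q`** (`hQM0 : klEngM₃ β U ≤ Q.M0 β`, `hQCL4 : 4 ≤ Q.CL β 0`; door `U ≤ klEngU₀4 P R c`):
ANY comparison histories (empty at scale `0`), every angle, budget `Q.CL β 0/4/L₁`. -/
theorem twoLeg_scale0_hcut_GQ (G : GeoConsts) (Q : EngConsts) (P : SplitConsts) {R : RenConsts} (hR : R.WF) (c : ℝ) {μ : ℝ} (hμ : μ ∈ klWindowC)
    {U : ℝ} (hU : 0 < U) (hU₀ : U ≤ klEngU₀4 P R c) {β : ℝ} (hβ : klBetaMin ≤ β) {L : ℕ} (hL : klEngL₃ β U ≤ L)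
    (hQM0 : ∀ L' : ℕ, klEngM₃ β U L' ≤ Q.M0 β L') (hQCL4 : 4 ≤ Q.CL β 0)
    (Mq : ℕ → ℕ) (L₁ M₁ M₂ : ℕ) [NeZero L₁] [NeZero M₁] [NeZero M₂] (hLL₁ : L ≤ L₁) (hM₁ : Q.M0 β L₁ ≤ M₁)
    (_hMq : Mq L₁ ≤ M₁) (h12 : M₁ ≤ M₂)
    (_h₁ : ∀ j < 0, histV17F2 L₁ M₁ G P Q R β U μ j ∧ TwoLegSlopes L₁ M₁ R β U μ (klFlowFrameU L₁ M₁ β U μ j) j)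
    (_h₂ : ∀ j < 0, histV17F2 L₁ M₂ G P Q R β U μ j ∧ TwoLegSlopes L₁ M₂ R β U μ (klFlowFrameU L₁ M₂ β U μ j) j) (θ : ℝ) :
    |klLocalPart L₁ M₁ β U μ (klFlowFrameU L₁ M₁ β U μ 0) 0 θ -
        klLocalPart L₁ M₂ β U μ (klFlowFrameU L₁ M₂ β U μ 0) 0 θ| ≤ Q.CL β 0 / 4 / L₁ := by
  have hL₁pos : (0 : ℝ) < L₁ := by exact_mod_cast Nat.pos_of_ne_zero (NeZero.ne L₁)
  have hβL₁ : β ≤ (L₁ : ℝ) := le_of_klEngL₃_le (hL.trans hLL₁)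
  have hM₁' : 2 ^ 10 * (⌈|β|⌉₊ + 1) ^ 2 * (L₁ + 1) ^ 2 ≤ M₁ := (hQM0 L₁).trans hM₁
  have hK0 : FrameOK R U 0 μ 0 := klFrameOK_zeroC hR U 0 hμ
  have h1 := twoLeg_scale0_hcutF_of_small hR hU (le_inv_two_pow_rsq_of_le_klEngU₀4 P hU₀) hμ hK0 hβ L₁ M₁ M₂ hβL₁ hM₁' h12 θ
  refine h1.trans (div_le_div_of_nonneg_right ?_ hL₁pos.le)
  linarith

/-- **The SPATIAL nested leg of (E3f-F)₀ for a generic package `Q`** (`hQM0`, `hQCL4`; door `U ≤ klEngU₀9 P R c`): for every reader threshold (unused), all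
`L ≤ L₁ ∣ L₂`, `M₂` above both thresholds, ANY comparison histories and every angle, budget `Q.CL β 0/4/L₁` (p1b's `…_spLeg_le_inv`: `≤ 1/L₁`). -/
theorem twoLeg_scale0_hsp_GQ (G : GeoConsts) (Q : EngConsts) (P : SplitConsts) {R : RenConsts} (hR : R.WF) (c : ℝ) {μ : ℝ} (hμ : μ ∈ klWindowC)
    {U : ℝ} (hU : 0 < U) (hU₉ : U ≤ klEngU₀9 P R c) {β : ℝ} (hβ : klBetaMin ≤ β) {L : ℕ} (hL : klEngL₃ β U ≤ L)
    (hQM0 : ∀ L' : ℕ, klEngM₃ β U L' ≤ Q.M0 β L') (hQCL4 : 4 ≤ Q.CL β 0)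
    (Mq : ℕ → ℕ) (L₁ L₂ M₂ : ℕ) [NeZero L₁] [NeZero L₂] [NeZero M₂] (hLL₁ : L ≤ L₁) (hdvd : L₁ ∣ L₂)
    (hM₁ : Q.M0 β L₁ ≤ M₂) (_hMq₁ : Mq L₁ ≤ M₂) (hM₂ : Q.M0 β L₂ ≤ M₂) (_hMq₂ : Mq L₂ ≤ M₂)
    (_h₁ : ∀ j < 0, histV17F2 L₁ M₂ G P Q R β U μ j ∧ TwoLegSlopes L₁ M₂ R β U μ (klFlowFrameU L₁ M₂ β U μ j) j)
    (_h₂ : ∀ j < 0, histV17F2 L₂ M₂ G P Q R β U μ j ∧ TwoLegSlopes L₂ M₂ R β U μ (klFlowFrameU L₂ M₂ β U μ j) j)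
    (θ : ℝ) :
    |klLocalPart L₁ M₂ β U μ (klFlowFrameU L₁ M₂ β U μ 0) 0 θ - klLocalPart L₂ M₂ β U μ (klFlowFrameU L₂ M₂ β U μ 0) 0 θ| ≤
      Q.CL β 0 / 4 / L₁ := by
  obtain ⟨b, hb⟩ := hdvd
  have hLb : L₂ = b * L₁ := by rw [hb, mul_comm]
  have hL₁pos : (0 : ℝ) < L₁ := by exact_mod_cast Nat.pos_of_ne_zero (NeZero.ne L₁)
  have h := abs_klLocalPart_flowFrame_zero_spLeg_le_inv P hR hμ hU hU₉ hβ hLb (hL.trans hLL₁) ((hQM0 L₁).trans hM₁)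
    ((hQM0 L₂).trans hM₂) θ
  refine h.trans (div_le_div_of_nonneg_right ?_ hL₁pos.le)
  linarith

/-! ## §2 (M) with package, thresholds and jet tables as binders -/

/-- **STUB (M) WITH THE PACKAGE `(G, Q)`, THE THRESHOLDS `(c₃, U₀c)` AND THE JET TABLES `(cJ, cJ′)` AS BINDERS** (v2-ready; CE-, CR- and jet-table-generic):
rows `hGS`, `hQS`, `hQCL`, `hQCL4`, `hQM0`, doors `c₃ ≤ klEngC₃3 P R`, `U₀c ≤ klEngU₀9 P R c`; then (M)'s literal binder list at that package ⇒
`TwoLegStepV17F2 L M G P Q R β U μ 0`.  (`hP`, `hfr`, `hE` are carried for the literal shape only.) -/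
theorem stub_twoLeg_scale0_GQJ (G : GeoConsts) (Q : EngConsts) (cJ cJ' : ℕ → ℝ) {c₃ U₀c : ℝ} (P : SplitConsts) (R : RenConsts) (c : ℝ)
    (hGS : ∀ k, cJ k ≤ G.S k) (hQS : ∀ k, cJ' k ≤ Q.S' k) (hQCL : ∀ (β : ℝ) (n : ℕ), 0 ≤ Q.CL β n)
    (hQCL4 : ∀ β : ℝ, 4 ≤ Q.CL β 0) (hQM0 : ∀ (β U : ℝ) (L : ℕ), klEngM₃ β U L ≤ Q.M0 β L)
    (hc₃ : c₃ ≤ klEngC₃3 P R) (hU₀ : U₀c ≤ klEngU₀9 P R c) (hP : P.WF) (hR : R.WF2) (hc : 0 < c) (hc3 : c ≤ c₃)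
    (μ : ℝ) (hμ : μ ∈ klWindowC) (U : ℝ) (hU : 0 < U) (hUle : U ≤ U₀c) (β : ℝ) (hβ : klBetaMin ≤ β) (hβc : β ≤ Real.exp (c / U ^ 2))
    (L M : ℕ) [NeZero L] [NeZero M] (hL : klEngL₃ β U ≤ L) (hM : klEngM₃ β U L ≤ M)
    (hfr : FrameOK R U (nScales β) μ (klFlowFrameU L M β U μ 0))
    (hE : EngineBoundsAtV17F2 L M G P Q β U μ 0)
    (hJ : TwoLegReadJetBound L M cJ cJ' β U μ (klFlowFrameU L M β U μ 0) 0) :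
    TwoLegStepV17F2 L M G P Q R β U μ 0 := by
  have _ := hP; have _ := hfr; have _ := hE
  have hRge : ∀ j, 0 ≤ R.Gfr j := hR.1.2.2
  have hU9 : U ≤ klEngU₀9 P R c := hUle.trans hU₀
  have hcle : c ≤ klCurveC3 R := (hc3.trans hc₃).trans (klEngC₃3_le_klCurveC3 P hRge)
  have hU3 : U ≤ klEngU₀3 P R c := hU9.trans (klEngU₀9_le_klEngU₀3 P R c)
  have hUle' : U ≤ klCurveU0 R := hU3.trans (klEngU₀3_le_klCurveU0 P hRge c)
  have hU1 : U ≤ 1 := le_one_of_le_klEngU₀3 hU3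
  have hU1' : |U| ≤ 1 := by rw [abs_of_pos hU]; exact hU1
  obtain ⟨hs0, hs1, hfz, hf1⟩ := bareFrame_numerals_of_le_klEngU₀9 P hR.2.2 hU hU9
  exact twoLegStepV17F2_zero_of_readJetBound_bareSlopes G Q hR.1 hc hcle hμ hU hUle' hU1 hβ hβc hL hM (hQCL β 0) hGS hQS hJ
    (klE3A1_pos R) (bareAlphaOne_le_klE3A1 R hU1') hs0 hs1 hfz hf1
    (twoLeg_scale0_hcut_GQ G Q P hR.1 c hμ hU (hU9.trans (klEngU₀9_le_klEngU₀4 P R c)) hβ hL (hQM0 β U) (hQCL4 β))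
    (twoLeg_scale0_hsp_GQ G Q P hR.1 c hμ hU hU9 hβ hL (hQM0 β U) (hQCL4 β))

/-- **SANITY INSTANCE at the registered v1 package** (`klEngGeo7`, `klEngQ7 P R`, `klEngC₃6`, `klEngU₀9`, tables `klC4aJetC` / `klC4aJetC' P R`): the GQJ shell
recovers (M)'s registered statement (= `stub_twoLeg_scale0`, p547354) — so the v2 re-closer is the same line with the v2 rows. -/
theorem stub_twoLeg_scale0_GQJ_klEng7 (P : SplitConsts) (R : RenConsts) (c : ℝ) (hP : P.WF) (hR : R.WF2) (hc : 0 < c)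
    (hc3 : c ≤ klEngC₃6 P R) (μ : ℝ) (hμ : μ ∈ klWindowC) (U : ℝ) (hU : 0 < U) (hUle : U ≤ klEngU₀9 P R c) (β : ℝ) (hβ : klBetaMin ≤ β)
    (hβc : β ≤ Real.exp (c / U ^ 2)) (L M : ℕ) [NeZero L] [NeZero M] (hL : klEngL₃ β U ≤ L) (hM : klEngM₃ β U L ≤ M)
    (hfr : FrameOK R U (nScales β) μ (klFlowFrameU L M β U μ 0))
    (hE : EngineBoundsAtV17F2 L M klEngGeo7 P (klEngQ7 P R) β U μ 0)
    (hJ : TwoLegReadJetBound L M klC4aJetC (klC4aJetC' P R) β U μ (klFlowFrameU L M β U μ 0) 0) :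
    TwoLegStepV17F2 L M klEngGeo7 P (klEngQ7 P R) R β U μ 0 :=
  stub_twoLeg_scale0_GQJ klEngGeo7 (klEngQ7 P R) klC4aJetC (klC4aJetC' P R) P R c klC4aJetC_le_klEngGeo7_S
    (fun k => by rw [klEngQ7_S']; exact klC4aJetC'_le_klEngQ6_S' P R k) (fun β n => by rw [klEngQ7_CL]; exact klEngQ6_CL_nonneg P R β n)
    (fun β => by rw [klEngQ7_CL]; exact four_le_klEngQ6_CL_zero P R β) (fun β U L => le_of_eq rfl)
    (klEngC₃6_le_klEngC₃3 P R) le_rfl hP hR hc hc3 μ hμ U hU hUle β hβ hβc L M hL hM hfr hE hJ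

end Summit.HubbardSuperconductivity.HubbardSuperconductivity.Theorems.EngineV8

end
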